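import Literature.AlgebraicGeometry.HodgeTheory.SemiregularVariationalHodgeISemiregularModel
import Literature.AlgebraicGeometry.Deformation.VectorBundleLifting
import HarnessLib

/-!
# Pridham 2024 (Forum Math. Sigma 12, e126), Cor. 2.25 and Remark 2.27: the semiregularity map kills every
# obstruction to deforming a sheaf along the Hodge locus — INFINITESIMAL form, finite locally free case

Family `hodge`, layer `Literature/AlgebraicGeometry/HodgeTheory`. NAMED FACT (D-0014), a REFEREED sibling of
the preprint-tagged renderings of [Perry2026Semiregularity, Thm. 1.1] (`SemiregularVariationalHodgeFull.lean`,
`SemiregularVariationalHodgeTwisted.lean`) and of [BuchweitzFlenner2003, Thm. 5.1]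
(`SemiregularVariationalHodgeISemiregularModel.lean`, whose binder shape this file copies verbatim). Requested on the
bus of the computation cell `pub-hsemireg` (run/shared/lean/pub/pub-hsemireg/: operator directive 2026-08-22T11:21:22Z,
seat lit-3 "type Pridham, Forum Math. Sigma 2024 = arXiv:1208.3111, Cor. 2.23 + Rem. 2.24 AS PRINTED"; memos
`general-structure/PERRY-SUBSTITUTE-GS.md` §1 (R1.1), `lit/PERRY-THM11-TYPING.md` §5,
`theory/TH2-PERRY-ASSEMBLY-TYPABILITY.md` §2–§3, `lit/PRIDHAM-FMS2024-TYPING-lit3.md`).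

NUMBERING. The cell's early memos quote the superseded arXiv text (held corpus text `paper:arxiv-1208.3111`, chunk
p0009): arXiv Cor. 2.21 / Rem. 2.22 / **Cor. 2.23** / **Rem. 2.24** / Rem. 2.13 / Lemma 1.7 are, in the PUBLISHED version
(Forum Math. Sigma 12 (2024) e126, doi:10.1017/fms.2024.132, CC-BY 4.0; page texts in the cell folder
`theory/th1-perry/Pridham2024-FMS-e126-text/`), Rem. 2.23 / — / **Cor. 2.25** / **Rem. 2.27** / Rem. 2.21 / Lemma 1.8;
Rem. 2.26 (μ_r-gerbes) exists only in the published version. Below "FMS" = published, "arXiv" = held arXiv text; all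
citations in `[cite:]` tags are to the PUBLISHED numbering.

## Source, verbatim

* FMS Intro Theorem (p. 2 L39–53) = the special case of Cor. 2.25 the cell uses: "Take a local Artinian `ℂ`-algebra
  `A`, a smooth morphism `X → Spec A` of Artin stacks and square-zero ideal `I ⊂ A` with quotient `B = A/I`. Then for
  any perfect complex `ℱ` over `X' := X ⊗_A B`, with obstruction `o(ℱ) ∈ Ext²_{𝒪_{X'}}(ℱ, ℱ ⊗_B I)` to deforming `ℱ`
  to a complex of `𝒪_X`-modules, the image of the Chern character `ch_p(ℱ)` under the map
  `H^{2p}(X'(ℂ)_an, ℚ) ≅ H^{2p}(X(ℂ)_an, ℚ) → H^{2p}(X(ℂ)_an, A) ≅ H^{2p}(X, Ω^•_{X/A})` lies in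
  `F^p H^{2p}(X, Ω^•_{X/A})` if and only if `o(ℱ)` maps to zero under the composite map
  `Ext²_{𝒪_{X'}}(ℱ, ℱ ⊗_B I) —σ_{p−1}→ H^{p+1}(X, I Ω^{p−1}_{X/A}) → H^{2p}(X, Ω^{<p}_{X/A})`."
  (p. 3 L1–3: "if the family `X` is constant over `A` (i.e., `X ≃ X_0 × Spec A`), then the condition `ch_p(ℱ) ∈ F^p`
  is automatically satisfied and the obstruction `o(ℱ)` always maps to zero (Remark 2.23).")
* FMS **Cor. 2.25** (p. 19 L44–56): "Take a local Artinian simplicial `ℂ`-algebra `A`, a derived Artin `n`-stack `X`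
  over `A` whose underived truncation is locally of finite type, and a square-zero simplicial ideal `I ⊂ A` with
  quotient `e : A → B`. Then for any perfect complex `ℱ` over `X' := X ⊗^L_A B`, with
  `o_e(ℱ) ∈ Ext²_{𝒪_{X'}}(ℱ, ℱ ⊗_B I)` the obstruction to deforming `ℱ` to an `𝒪_X`-module in complexes, the image
  of the Chern character `ch_p(ℱ)` under the map
  `H^{2p}(|X'(ℂ)_an|, ℚ) ≃ H^{2p}(|X(ℂ)_an|, ℚ) → H^{2p}(|X(ℂ)_an|, A) ≃ H^{2p}(LDR(X/A))` lies in
  `F^p H^{2p}(LDR(X/A))` if and only if the image of `𝓛_{p−1}(o_e(ℱ))` under the map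
  `H^{p+1}(X, LΩ^{p−1}_{X/A} ⊗^L_A I) → H^{2p}(X, Tot^Π(LΩ^{<p}_{X/A}, d))`, coming from the inclusion `I ↪ A`, is
  zero."  = arXiv **Cor. 2.23** (p0009 L72–87): "Take an Artinian local simplicial `R`-algebra `A` with residue
  field `k`, and a square-zero extension `e : I → A → B`. Then for any `ℰ ∈ Perf_𝔛(B)` the image of the obstruction
  `o_e(ℰ)` under the maps `Ext²_𝔛(ℰ, ℰ ⊗_B I) —𝓛_{p−1}→ H^{p+1}(𝔛, LΩ^{p−1}_{𝔛/R} ⊗_R I) → H^{2p}((LDR(𝔛_A/A)/F^p) ⊗_A I)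
  → H^{2p}(LDR(𝔛_A/A)/F^p)` is the obstruction to lifting `ch_p(ℰ)` from `H^{2p}(LDR(𝔛_B/B))^{hor} ∩ F^p H^{2p}(LDR(X_B/B))`
  to `H^{2p}(LDR(𝔛_A/A))^{hor} ∩ F^p H^{2p}(LDR(𝔛_A/A))`."
* FMS **Rem. 2.27** (p. 20 L28–57) = arXiv **Rem. 2.24** (p0009 L89–112): "Assume that `R` is a Noetherian `ℚ`-algebra,
  with `X` a smooth proper scheme over `Spec R`. Then the Lefschetz principle and degeneration of the Hodge–de Rham
  spectral sequence [Del, §5–6] imply there exists an `R`-linear quasi-isomorphism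
  `DR(X/R)/F^p ≃ ⊕_{i=0}^{p−1} RΓ(X, Ω^i_{X/R})[i]` […]. For any simplicial ideal `I` in a simplicial `R`-algebra `A` for
  which `π_*I → π_*A` is injective, the map `H^{p+1}(X, Ω^{p−1}_{X/R} ⊗_R I) → H^{2p}(X, (DR(𝒪_X/R)/F^p) ⊗_R A)` is
  therefore injective. In particular, this means that the element `𝓛_{p−1}(o_e(ℱ))` in `H^{p+1}(X, Ω^{p−1}_{X/R} ⊗_R I)`
  will vanish provided its image in `H^{2p}(X, DR(𝒪_{X_A}/A)/F^p)` does so. In the case where `X` is a smooth proper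
  scheme over an Artinian `ℂ`-algebra, vanishing of `𝓛_{p−1}(o_e(ℱ))` itself is thus equivalent to the conditions of
  Corollary 2.25 (taking `R = A`), which we can paraphrase as saying that `𝓛_{p−1}(o_e(ℱ))` is the obstruction to the
  unique horizontal lift of `ch^dR_p(ℱ)` still lying in `F^p H^{2p} DR(X/A)`, or equivalently remaining of pure Hodge
  type `(p, p)`. Taking an open substack `𝔐 ⊂ Perf_X` for which that obstruction vanishes at all points `[ℱ]` (for
  instance, by restricting to the Hodge locus of [Voi]), we then have a functorial obstruction theory
  `([ℱ] ∈ 𝔐(B)) ↦ ker(𝓛_{p−1} : Ext²_{𝒪_{X_B}}(ℱ, ℱ ⊗^L_B −) → H^{p+1}(X, Ω^{p−1}_{X/R}) ⊗^L_R −)` for `𝔐` as a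
  subspace of the standard obstruction theory."
* FMS **Rem. 2.21** (p. 18 L2–5): "[BF2, Theorem 5.1.3 and Proposition 6.2.1] ensure that `𝓛` is the same as the
  semiregularity map `σ` of [BF1], given by applying the exponential of the Atiyah class then taking the trace";
  the diagrams of Cor. 2.22 (p. 18 L15–30) and Cor. 2.24 (p. 18 L68–77, p. 19 L12–30) print "`𝓛_{p−1} = σ_{p−1}`".
* FMS **Lemma 1.8** (p. 7 L15–27): "we have a functorial obstruction `o_e(x) ∈ D¹_x(F, I)`, which is zero if and only
  if `[x]` lies in the image of `e_* : π_0(FA) → π_0(FB)`" (for `F = Perf_X`: `ℱ` over `B` lifts to `A` iff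
  `o_e(ℱ) = 0`).
* Standing hypotheses of §2 (FMS Def. 2.15, p. 17 L22: "a simplicial commutative `ℚ`-algebra `R` and a derived
  `∞`-stack `X` over `R` […] `J^p_X(A) := J^p(X_A/A, ℚ)`"; arXiv §2.3 head, p0008 L16–17: "Fix a simplicial commutative
  `k`-algebra `R`, and a strongly quasi-compact derived geometric Deligne–Mumford `n`-stack `𝔛` over `R`. Given
  `A ∈ sCAlg_R`, from now on we will write `𝔛_A := 𝔛 ⊗^L_R A`"; arXiv p0003 L82: "`k` will denote a field of
  characteristic zero").

## What the printed statements give, assembled (the sentence this file renders)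

Let `R` be a Noetherian `ℚ`-algebra and `X → Spec R` smooth proper (Rem. 2.27), `A → B = A/I` a square-zero
extension of local Artinian `R`-algebras with residue field `ℂ` and `ℱ` a perfect complex on `X_B = X ⊗_R B`. IF for
every `p` in a set `I₀` of degrees the unique horizontal lift of `ch_p(ℱ)` to `H^{2p}_dR(X_A/A)` lies in `F^p` (Cor. 2.25
⟸-direction, with Rem. 2.27's injectivity for the scheme `X_A/A`), THEN `σ_{p−1}(o_e(ℱ)) = 𝓛_{p−1}(o_e(ℱ)) = 0` for
all `p ∈ I₀` (Rem. 2.21); hence if `(σ_{p−1})_{p ∈ I₀}` is jointly injective on `Ext²_{X_B}(ℱ, ℱ ⊗_B I)` then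
`o_e(ℱ) = 0`, i.e. `ℱ` lifts to `X_A` (Lemma 1.8) — "we then have a functorial obstruction theory
`[ℱ] ↦ ker 𝓛_{p−1}`" with zero obstruction space.

## Rendering (binders; every binder is a printed hypothesis or a strengthening of one)

Carriers verbatim those of `BuchweitzFlenner2003_variationalHodge_ISemiregular_model` (module docstring there): a Chern
character theory `C : ChernCharacterBetti`; an algebraic smooth projective family `π : 𝒳 ⟶ S` of relative dimension
`n` over a SMOOTH `ℂ`-scheme `S` (so every affine open `Spec R ⊆ S` has `R` a regular Noetherian `ℚ`-algebra and
`𝒳_R → Spec R` smooth projective: Rem. 2.27's "`R` Noetherian `ℚ`-algebra, `X` a smooth proper scheme over `Spec R`");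
a cohomologically locally trivial open `U ⊆ S(ℂ)` with base point `s₀`; a MODEL `e : X₀ ≅ 𝒳_{s₀}` of the special
fibre; `E₀` FINITE LOCALLY FREE on `X₀` (special case of "perfect complex"; `Ext^{<0}` is then automatic); a set `I`
of CHERN degrees with `(σ_{p−1})_{p ∈ I}` jointly injective on `Ext²(E₀, E₀)` — `IsISemiregular hE₀ {q | q + 1 ∈ I}`,
the tree's REAL `σ_q = Tr(− ∘ At^q)` (`SemiregularityHigherSigma.sigmaHigher`; the scalars `(−1)^q/q!` of
`exp(−At)` do not change kernels over `ℂ`); and the HODGE-LOCUS hypothesis rendered ON THE BASE: for every `p ∈ I`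
the transports of `(e⁻¹)^* ch_p(E₀)` along all paths in `U` are of type `(p, p)` ("restricting to the Hodge locus of
[Voi]": `U` lies in the Hodge locus of the flat class in every degree `p ∈ I`).
CONCLUSION (the infinitesimal lifting statement, on the tree's real deformation carrier `Deformation.LiftsAlong` of
`Deformation/VectorBundleLifting.lean`): for every local Artinian `ℂ`-algebra `A` (FMS Cor. 2.25 "local Artinian
`ℂ`-algebra `A`"), every surjection `f : A → B` of `ℂ`-algebras with `𝔪_A · ker f = 0` (a SMALL extension; in
particular `(ker f)² = 0`: "square-zero ideal `I ⊂ A` with quotient `B`"), every `ℂ`-point `ρ : B → ℂ`, every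
`A`-point `a : Spec A → S` of `S` over `ℂ` whose closed point is `s₀`, every choice of the base changes
`X_A = 𝒳 ×_S Spec A` ("`X → Spec A` smooth"), `X_B = X_A ×_{Spec A} Spec B` ("`X' := X ⊗_A B`") and of the closed
fibre `X₀ = X_B ×_{Spec B} Spec ℂ` embedded compatibly with `e` (three `IsPullback` squares and one equation), and
every VECTOR BUNDLE `F` on `X_B` with `F|_{X₀} ≅ E₀` ("perfect complex `ℱ` over `X'`" deforming `E₀`): `F` lifts to
a vector bundle on `X_A` along `X_B ⟶ X_A`.

## The three sentences between the print and the rendering (standard; written out, not cited as Pridham)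

(G-a) HODGE LOCUS ON A REDUCED BASE. `S` is smooth, so on a contractible neighbourhood `U' ⊆ U` of `s₀` the flat
class `w` (single-valued there) is a holomorphic section of the Hodge bundle `ℋ = R^{2p}π_*Ω^•_{𝒳/S}` lying in the
subbundle `F^p` at every point (hypothesis), hence `w ∈ Γ(U', F^p)` (the quotient `ℋ/F^p` is LOCALLY FREE —
[Deligne1968, Thm. (5.5)(i)]: the `R^qπ_*Ω^p_{𝒳/S}` and the graded pieces are locally free, of formation compatible with
every base change — and `U'` is REDUCED since `S` is smooth, so the image of `w` in `Γ(U', ℋ/F^p)`, a section of a vector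
bundle vanishing at every point, is zero); by the same base-change clause ([Deligne1968, (5.5.3)–(5.5.4)] for the
Artinian identification), for an Artinian point `a : Spec A → S` at `s₀` the unique horizontal lift of
`ch_p(F) = w(s₀)` (topological Chern character of `F|_{X₀} ≅ E₀`, `|X_B(ℂ)_an| = X₀(ℂ)`) to `H^{2p}_dR(X_A/A) = a^*ℋ`
is `a^*w ∈ a^*F^p = F^p H^{2p}_dR(X_A/A)` — the ⟸-hypothesis of Cor. 2.25 for every `p ∈ I`. (This is exactly how
the cell's chain uses Rem. 2.27: `theory/TH2-ASSEMBLY-NOTE-2PAGE.md` (L4)–(L5), ledger H9–H11.)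
(G-b) SMALL-EXTENSION BASE CHANGE OF `σ`. For `𝔪_A · I = 0` (`I = ker f`), `I` is a `ℂ = A/𝔪_A`-vector space and
`F ⊗_B I ≅ j_*(E₀ ⊗_ℂ I)` (`j : X₀ ↪ X_B`), so `Ext²_{X_B}(F, j_*(E₀ ⊗ I)) ≅ Ext²_{X₀}(Lj^*F, E₀) ⊗_ℂ I = Ext²_{X₀}(E₀, E₀) ⊗_ℂ I`
(adjunction `Lj^* ⊣ j_*`; `Lj^*F = j^*F ≅ E₀` BECAUSE `F` is flat over `X_B`, being finite locally free — for a
perfect `A`-flat `ℱ` the same line reads `Lι^* ⊣ ι_*`) and `H^{p+1}(X_A, Ω^{p−1}_{X_A/A} ⊗_A I) ≅ H^{p+1}(X₀, Ω^{p−1}_{X₀}) ⊗_ℂ I`,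
under which `σ_{p−1, X_B/B}(F) = σ_{p−1, X₀}(E₀) ⊗ id_I` (`At_F` restricts to `At_{E₀}` under `j^*` by functoriality of
the Atiyah class / jet sequence under pull-back, and the trace commutes with base change). Hence injectivity of
`(σ_{p−1}(E₀))_{p ∈ I}` gives injectivity on the printed source `Ext²_{X_B}(F, F ⊗_B I)`.
(G-c) THE LIFT IS A VECTOR BUNDLE. Lemma 1.8 (with Lemma 1.9, p. 7 L48–49: "`Perf_X` is homotopy-preserving and
homotopy-homogeneous", `D^i_ℱ(Perf_X, M) ≃ Ext^{i+1}(ℱ, ℱ ⊗_A M)`) yields a PERFECT lift `G ∈ Perf(X_A)` with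
`G ⊗^L_A B ≃ F`; the triangle `F ⊗_B I ≃ G ⊗^L_A I → G → G ⊗^L_A B ≃ F` (`I² = 0`, `F` flat over `B`) gives `H^i(G) = 0`
for `i ≠ 0` and `0 → F ⊗_B I → H⁰G → F → 0`, so `H⁰G` is finitely presented and `A`-flat (local flatness criterion along
the square-zero `I`), i.e. a VECTOR BUNDLE `E₁` on `X_A` with `i^*E₁ ≅ F` — exactly `LiftsAlong i F` ([StacksProject,
Tag 08VR (1)] is the module-side statement, quoted in `Deformation/VectorBundleLifting.lean`).
All three sentences are standard and are the cell's (L3)/(L5)/H-ledger glue (`theory/TH2-ASSEMBLY-NOTE-2PAGE.md`);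
none is a claim of this file's source. (Wording of (G-a)–(G-c) read without objection by the cell's th-2, lit-1 and
ref-3 seats, 2026-08-22; their precisions are folded in above.)

## Hypotheses the `pub-hsemireg` STEP-0 chain must discharge to USE this fact (binder ↔ print ↔ who)

| binder | printed hypothesis | discharged in the cell by |
|---|---|---|
| `IsSmoothProjectiveFamily π n`, `Smooth S.hom` | Rem. 2.27 "`X` smooth proper scheme over `Spec R`, `R` Noetherian `ℚ`-algebra"; Cor. 2.25 "`X → Spec A` smooth" | the chart: universal abelian scheme over a smooth (neat-level) base chart (th-2/th-3, `SiegelComponentChartAt`) |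
| `hU`, `s₀`, Hodge-type hypothesis ∀ `p ∈ I` | Rem. 2.27 "restricting to the Hodge locus of [Voi]" — in EVERY degree `p` whose `σ_{p−1}` is used | chart = a component of the Hodge locus of the class in ALL degrees used ([G3] of PERRY-SUBSTITUTE-GS; red-3 §32) |
| `E₀` finite locally free, `F` a vector bundle | "perfect complex `ℱ`" — SPECIAL CASE ONLY | object seats: ONLY untwisted vector-bundle representatives enter this door; the T4a object `Φ(I_p ⊠ I_q)` (a two-term B-twisted complex) does NOT (no carrier: th-2 §2 K2/K5) |
| `IsISemiregular hE₀ {q ∣ q+1 ∈ I}` | "`ker 𝓛_{p−1}`" = 0 on the obstruction group, via Rem. 2.21 `𝓛 = σ` and (G-b) | the engines' exact rank certificate for `(σ_{p−1})_{p ∈ I}` (FULL `σ`: `I = Set.univ`, cor. below) |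
| `A` local Artinian, `f` small, `ρ`, `a` centred at `s₀`, the three pullback squares, `hje` | Cor. 2.25 "local Artinian `ℂ`-algebra `A`", "square-zero ideal", "`X' := X ⊗_A B`" | the assembly seat (p7): formal smoothness of the deformation functor of `E₀` over Artinian points of the chart — iterate this fact along small extensions |
| conclusion `LiftsAlong i F` | Lemma 1.8: `o_e(ℱ) = 0` iff `ℱ` lifts | consumed by: l.f.p. moduli + "formally smooth ⇒ smooth ⇒ open image" (Lieblich 2006 4.2.1 / EGA IV 17; NOT in this file, NOT in the tree) or Perry 2022 Prop. 8.1 |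

## What is NOT rendered (and why)

* Perfect complexes, `Ext^{<0}(ℱ, ℱ) = 0`, μ_r-twisted objects (FMS Rem. 2.26), derived / Artin-stack `X`: no real
  carrier for the Atiyah class / `σ` of a complex or for gerbes (cell memo TH2-PERRY-ASSEMBLY-TYPABILITY §2, K2/K5).
* The ⟹-direction of Cor. 2.25 and the per-degree VANISHING `𝓛_{p−1}(o_e(ℱ)) = 0` as an identity: the tree's real
  obstruction class (`Deformation/ObstructionClassWellDefined.lean`) is built only for thickenings with `𝓘 ≅ 𝒪`; the
  rendering keeps the consequence "jointly injective on `I` ⟹ lifts", which is all the chain uses.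
* The Hodge filtration on `H_dR(X_A/A)` and horizontal lifts over `A` (no carrier; replaced by (G-a) on the base).
* The constant-family case (FMS p. 3 L1–3, Rem. 2.23: "`σ` annihilates all obstructions", Buchweitz–Flenner's first
  conjecture, also [BandieraLepriManetti2023] for `R = ℂ`) is the instance `S = Spec ℂ`, `𝒳 = X₀` of the fact (the
  Hodge hypothesis is then the statement that `ch_p(E₀)` is of type `(p, p)`); it is not restated separately.

## What is PROVED here

* `Pridham2024_semiregular_liftsOverHodgeLocus_model` — the FULL-`σ` form (`IsISemiregular hE₀ Set.univ`, Hodge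
  hypothesis in every degree) follows from the `I`-form (`I := Set.univ`).
* `Pridham2024_ISemiregular_liftsOverHodgeLocus` — the fixed-fibre form (`X₀ := 𝒳_{s₀}`, `e := Iso.refl _`).
* `Pridham2024_ISemiregular_liftsOverHodgeLocus_model_finset` — the `I : Finset ℕ` form (the binder shape of the
  sibling `BuchweitzFlenner2003_variationalHodge_ISemiregular_model` and of the cell's assembly interface), the case
  `↑I` of the fact (`Finset.mem_coe` is `Iff.rfl`).
* `LiftsOverArtinianPointsAt π s₀ X₀ e E₀` — a DEFINITION (with body): the fact's infinitesimal CONCLUSION packaged by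
  name (the telescope "for every local Artinian `A`, small `f : A ↠ B`, `ρ`, `a` centred at `s₀`, base changes
  `X_A`, `X_B`, closed fibre `j` compatible with `e`, vector bundle `F` on `X_B` with `F|_{X₀} ≅ E₀`: `LiftsAlong i F`"),
  so that a CONSUMER (the cell's assembly seat p7, `AmplificationChainPridham`: an algebraisation hypothesis whose INPUT
  is this conclusion) links to it BY NAME instead of re-spelling fifteen binders;
  `Pridham2024_ISemiregular_liftsOverHodgeLocus_model_iff` (the fact IS "hypotheses ⟹ `LiftsOverArtinianPointsAt`",
  `Iff.rfl`), and the repackaged corollaries `Pridham2024_ISemiregular_liftsOverArtinianPointsAt` (`I : Set ℕ`),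
  `…_finset` (`I : Finset ℕ`), `Pridham2024_semiregular_liftsOverArtinianPointsAt` (FULL `σ`).

## References

* [Pridham2024Semiregularity] J. P. Pridham, Semiregularity as a consequence of Goodwillie's theorem, Forum Math.
  Sigma 12 (2024) e126, doi:10.1017/fms.2024.132 (arXiv:1208.3111): Intro Theorem p. 2; Lemma 1.8, Lemma 1.9; Rem. 2.21;
  Cor. 2.22; Rem. 2.23; Cor. 2.25; Rem. 2.27 (arXiv numbering: Lemma 1.7, 1.8; Rem. 2.13; — (split case only: Lemma 2.14 /
  Cor. 2.15); Cor. 2.15 + Cor. 2.21; Cor. 2.23; Rem. 2.24 — full concordance in the cell file `lit/PRIDHAM-FMS2024-LOCATOR-SHEET-lit3.md` §6).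
* [BuchweitzFlenner2003] R.-O. Buchweitz, H. Flenner, Compositio Math. 137 (2003), §5 (I-semiregular), Thm. 5.1.
* [BuchweitzFlenner2008HH] R.-O. Buchweitz, H. Flenner, Adv. Math. 217 (2008), Thm. 5.1.3, Prop. 6.2.1 (Pridham's [BF2]:
  `𝓛 = σ`).
* [Deligne1968] P. Deligne, Publ. Math. IHÉS 35 (1968), Thm. 5.5 (degeneration and base change).
* [BandieraLepriManetti2023] R. Bandiera, E. Lepri, M. Manetti, Adv. Math. (2023) (the absolute case `R = ℂ`).
* [StacksProject] Tag 08VR (lifting across first-order thickenings; the carrier `LiftsAlong`).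
-/

noncomputable section

open CategoryTheory AlgebraicGeometry
open _root_.Topology _root_.Filter
open Literature.AlgebraicTopology.SingularHomology

namespace Literature.AlgebraicGeometry.HodgeTheory

open Literature.AlgebraicGeometry.Deformation (LiftsAlong)

/-- **Pridham 2024, Cor. 2.25 with Rem. 2.27 (reduced obstruction theory on the Hodge locus), Rem. 2.21 (`𝓛 = σ`)
and Lemma 1.8 (`o_e`) — finite locally free case, special fibre up to a model isomorphism, infinitesimal form.**
Printed (FMS p. 2 L39–53 = Cor. 2.25, p. 19 L44–56): "Take a local Artinian `ℂ`-algebra `A`, a smooth morphism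
`X → Spec A` […] and square-zero ideal `I ⊂ A` with quotient `B = A/I`. Then for any perfect complex `ℱ` over
`X' := X ⊗_A B`, with obstruction `o(ℱ) ∈ Ext²_{𝒪_{X'}}(ℱ, ℱ ⊗_B I)` to deforming `ℱ` to a complex of `𝒪_X`-modules,
the image of the Chern character `ch_p(ℱ)` under the map `H^{2p}(X'(ℂ)_an, ℚ) ≅ H^{2p}(X(ℂ)_an, ℚ) → H^{2p}(X(ℂ)_an, A)
≅ H^{2p}(X, Ω^•_{X/A})` lies in `F^p H^{2p}(X, Ω^•_{X/A})` if and only if `o(ℱ)` maps to zero under the composite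
map `Ext² —σ_{p−1}→ H^{p+1}(X, I Ω^{p−1}_{X/A}) → H^{2p}(X, Ω^{<p}_{X/A})`"; Rem. 2.27 (p. 20 L28–57): for "`X` a
smooth proper scheme over `Spec R`", `R` a Noetherian `ℚ`-algebra, the last map is injective, "vanishing of
`𝓛_{p−1}(o_e(ℱ))` itself is thus equivalent to the conditions of Corollary 2.25", and "restricting to the Hodge
locus of [Voi] […] we then have a functorial obstruction theory `[ℱ] ↦ ker(𝓛_{p−1} : Ext²_{𝒪_{X_B}}(ℱ, ℱ ⊗_B −) →
H^{p+1}(X, Ω^{p−1}_{X/R}) ⊗_R −)`"; Rem. 2.21 (p. 18 L2–5): "`𝓛` is the same as the semiregularity map `σ` of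
[BF1]"; Lemma 1.8 (p. 7 L23–27): "`o_e(x)` […] is zero if and only if `[x]` lies in the image of
`e_* : π_0(FA) → π_0(FB)`" (its hypotheses for `F = Perf_X` are Lemma 1.9, p. 7 L48–49). Rendering (module docstring,
incl. the three standard glue sentences (G-a)–(G-c) and the table of what a consumer must discharge): for `π : 𝒳 ⟶ S` a smooth projective family of relative dimension
`n` over a SMOOTH `ℂ`-scheme, `U ∋ s₀` cohomologically locally trivial, a model `e : X₀ ≅ 𝒳_{s₀}`, `E₀` finite
locally free on `X₀` with `(σ_{p−1})_{p ∈ I}` jointly injective, and the transports of `(e⁻¹)^* ch_p(E₀)` of type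
`(p, p)` everywhere on `U` for every `p ∈ I`: every vector bundle `F` on `X_B = 𝒳 ×_S Spec B` restricting to `E₀`
on the closed fibre lifts to a vector bundle on `X_A = 𝒳 ×_S Spec A`, for every small extension `A ↠ B` of local
Artinian `ℂ`-algebras and every `A`-point of `S` centred at `s₀`. The perfect-complex / twisted generality of the
source is NOT rendered (no carrier).
[cite: Pridham2024Semiregularity, Cor. 2.25; Rem. 2.27; Rem. 2.21; Lemma 1.8–1.9; Intro Theorem p. 2 L39–53] -/
def Pridham2024_ISemiregular_liftsOverHodgeLocus_model : Prop :=
  ∀ (C : ChernCharacterBetti) ⦃𝒳 S : Motives.SchemeOver ℂ⦄ (π : 𝒳 ⟶ S) (n : ℕ),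
    Motives.IsSmoothProjectiveFamily π n → _root_.AlgebraicGeometry.Smooth S.hom →
    ∀ ⦃U : Set (Motives.ComplexPoints S)⦄ (hU : IsCohomologicallyLocallyTrivialOn π U) (s₀ : U)
      (X₀ : Motives.SchemeOver ℂ) (e : X₀ ≅ Motives.fiberOver π s₀.1)
      (E₀ : X₀.left.Modules) (hE₀ : Motives.IsFiniteLocallyFree E₀) (I : Set ℕ),
      IsISemiregular hE₀ {q | q + 1 ∈ I} →
      (∀ p ∈ I, ∀ (t : U) (γ : Path.Homotopic.Quotient s₀ t),
          IsOfHodgeType n (Motives.fiberOver π t.1) (2 * p) p p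
            (transportFun π (2 * p) hU γ (complexBetti.map e.inv (2 * p) (C.ch X₀ E₀ p)))) →
      -- the infinitesimal conclusion: lifting across every small extension at every `A`-point of `S` centred at `s₀`
      ∀ (A B : Type) [CommRing A] [Algebra ℂ A] [IsArtinianRing A] [IsLocalRing A]
        [CommRing B] [Algebra ℂ B] (f : A →ₐ[ℂ] B), Function.Surjective f →
        IsLocalRing.maximalIdeal A * RingHom.ker f = ⊥ →
        ∀ (ρ : B →ₐ[ℂ] ℂ) (a : Motives.specOver ℂ A ⟶ S),
          Spec.map (CommRingCat.ofHom (ρ.comp f).toRingHom) ≫ a.left = s₀.1.left →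
          ∀ ⦃XA XB : Scheme⦄ (gA : XA ⟶ 𝒳.left) (qA : XA ⟶ Spec (.of A)),
            IsPullback gA qA π.left a.left →
            ∀ (i : XB ⟶ XA) (qB : XB ⟶ Spec (.of B)),
              IsPullback i qB qA (Spec.map (CommRingCat.ofHom f.toRingHom)) →
              ∀ (j : X₀.left ⟶ XB),
                IsPullback j X₀.hom qB (Spec.map (CommRingCat.ofHom ρ.toRingHom)) →
                j ≫ i ≫ gA = e.hom.left ≫ (Motives.fiberι π s₀.1).left →
                ∀ (F : XB.Modules), Motives.IsVectorBundle F →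
                  Nonempty ((Scheme.Modules.pullback j).obj F ≅ E₀) →
                  LiftsAlong i F

/-- **The FULL-`σ` form** (the form the cell's chain uses: "FULL `σ` injective", Hodge hypothesis in every degree):
with `IsISemiregular hE₀ Set.univ` and the transports of `(e⁻¹)^* ch_p(E₀)` of type `(p, p)` on `U` for EVERY `p`,
the same lifting conclusion — the case `I = Set.univ` of `Pridham2024_ISemiregular_liftsOverHodgeLocus_model`
(`{q | q + 1 ∈ Set.univ} = Set.univ`). [cite: Pridham2024Semiregularity, Cor. 2.25; Rem. 2.27; Rem. 2.21; Lemma 1.8–1.9] -/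
theorem Pridham2024_semiregular_liftsOverHodgeLocus_model
    (h : Pridham2024_ISemiregular_liftsOverHodgeLocus_model) (C : ChernCharacterBetti)
    {𝒳 S : Motives.SchemeOver ℂ} (π : 𝒳 ⟶ S) (n : ℕ) (hπ : Motives.IsSmoothProjectiveFamily π n)
    (hS : _root_.AlgebraicGeometry.Smooth S.hom) {U : Set (Motives.ComplexPoints S)}
    (hU : IsCohomologicallyLocallyTrivialOn π U) (s₀ : U) (X₀ : Motives.SchemeOver ℂ)
    (e : X₀ ≅ Motives.fiberOver π s₀.1) (E₀ : X₀.left.Modules) (hE₀ : Motives.IsFiniteLocallyFree E₀)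
    (hsr : IsISemiregular hE₀ Set.univ)
    (hHodge : ∀ (p : ℕ) (t : U) (γ : Path.Homotopic.Quotient s₀ t),
      IsOfHodgeType n (Motives.fiberOver π t.1) (2 * p) p p
        (transportFun π (2 * p) hU γ (complexBetti.map e.inv (2 * p) (C.ch X₀ E₀ p))))
    (A B : Type) [CommRing A] [Algebra ℂ A] [IsArtinianRing A] [IsLocalRing A] [CommRing B] [Algebra ℂ B]
    (f : A →ₐ[ℂ] B) (hf : Function.Surjective f) (hsmall : IsLocalRing.maximalIdeal A * RingHom.ker f = ⊥)
    (ρ : B →ₐ[ℂ] ℂ) (a : Motives.specOver ℂ A ⟶ S)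
    (ha : Spec.map (CommRingCat.ofHom (ρ.comp f).toRingHom) ≫ a.left = s₀.1.left)
    {XA XB : Scheme} (gA : XA ⟶ 𝒳.left) (qA : XA ⟶ Spec (.of A)) (hA : IsPullback gA qA π.left a.left)
    (i : XB ⟶ XA) (qB : XB ⟶ Spec (.of B)) (hB : IsPullback i qB qA (Spec.map (CommRingCat.ofHom f.toRingHom)))
    (j : X₀.left ⟶ XB) (hj : IsPullback j X₀.hom qB (Spec.map (CommRingCat.ofHom ρ.toRingHom)))
    (hje : j ≫ i ≫ gA = e.hom.left ≫ (Motives.fiberι π s₀.1).left)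
    (F : XB.Modules) (hF : Motives.IsVectorBundle F) (hF₀ : Nonempty ((Scheme.Modules.pullback j).obj F ≅ E₀)) :
    LiftsAlong i F :=
  h C π n hπ hS hU s₀ X₀ e E₀ hE₀ Set.univ (IsISemiregular.mono hE₀ (fun _ _ => Set.mem_univ _) hsr)
    (fun p _ => hHodge p)
    A B f hf hsmall ρ a ha gA qA hA i qB hB j hj hje F hF hF₀

/-- **The fixed-fibre form**: `E₀` on the tree's chosen fibre `𝒳_{s₀}` itself (`X₀ := fiberOver π s₀`,
`e := Iso.refl _`, `(𝟙)^* = id` by `complexBetti.map_id`), the closed fibre of `X_B` embedded by `j` with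
`j ≫ i ≫ gA = fiberι`. [cite: Pridham2024Semiregularity, Cor. 2.25; Rem. 2.27; Rem. 2.21; Lemma 1.8–1.9] -/
theorem Pridham2024_ISemiregular_liftsOverHodgeLocus
    (h : Pridham2024_ISemiregular_liftsOverHodgeLocus_model) (C : ChernCharacterBetti)
    {𝒳 S : Motives.SchemeOver ℂ} (π : 𝒳 ⟶ S) (n : ℕ) (hπ : Motives.IsSmoothProjectiveFamily π n)
    (hS : _root_.AlgebraicGeometry.Smooth S.hom) {U : Set (Motives.ComplexPoints S)}
    (hU : IsCohomologicallyLocallyTrivialOn π U) (s₀ : U)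
    (E₀ : (Motives.fiberOver π s₀.1).left.Modules) (hE₀ : Motives.IsFiniteLocallyFree E₀) (I : Set ℕ)
    (hsr : IsISemiregular hE₀ {q | q + 1 ∈ I})
    (hHodge : ∀ p ∈ I, ∀ (t : U) (γ : Path.Homotopic.Quotient s₀ t),
      IsOfHodgeType n (Motives.fiberOver π t.1) (2 * p) p p (transportFun π (2 * p) hU γ (C.ch _ E₀ p)))
    (A B : Type) [CommRing A] [Algebra ℂ A] [IsArtinianRing A] [IsLocalRing A] [CommRing B] [Algebra ℂ B]
    (f : A →ₐ[ℂ] B) (hf : Function.Surjective f) (hsmall : IsLocalRing.maximalIdeal A * RingHom.ker f = ⊥)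
    (ρ : B →ₐ[ℂ] ℂ) (a : Motives.specOver ℂ A ⟶ S)
    (ha : Spec.map (CommRingCat.ofHom (ρ.comp f).toRingHom) ≫ a.left = s₀.1.left)
    {XA XB : Scheme} (gA : XA ⟶ 𝒳.left) (qA : XA ⟶ Spec (.of A)) (hA : IsPullback gA qA π.left a.left)
    (i : XB ⟶ XA) (qB : XB ⟶ Spec (.of B)) (hB : IsPullback i qB qA (Spec.map (CommRingCat.ofHom f.toRingHom)))
    (j : (Motives.fiberOver π s₀.1).left ⟶ XB)
    (hj : IsPullback j (Motives.fiberOver π s₀.1).hom qB (Spec.map (CommRingCat.ofHom ρ.toRingHom)))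
    (hje : j ≫ i ≫ gA = (Motives.fiberι π s₀.1).left)
    (F : XB.Modules) (hF : Motives.IsVectorBundle F) (hF₀ : Nonempty ((Scheme.Modules.pullback j).obj F ≅ E₀)) :
    LiftsAlong i F := by
  have key := h C π n hπ hS hU s₀ (Motives.fiberOver π s₀.1) (Iso.refl _) E₀ hE₀ I hsr
  simp only [Iso.refl_inv, complexBetti.map_id, Iso.refl_hom] at key
  refine key hHodge A B f hf hsmall ρ a ha gA qA hA i qB hB j hj ?_ F hF hF₀
  rw [hje]
  exact (Category.id_comp _).symm

/-- **`Finset` form** (the binder shape of the sibling `BuchweitzFlenner2003_variationalHodge_ISemiregular_model` and of the cell's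
assembly interface, `I : Finset ℕ`): the case `↑I` of `Pridham2024_ISemiregular_liftsOverHodgeLocus_model` (`Finset.mem_coe` is
`Iff.rfl`, so `IsISemiregular hE₀ {q | q + 1 ∈ I}` and the Hodge clause are the `Set` binders at `↑I` definitionally).
[cite: Pridham2024Semiregularity, Cor. 2.25; Rem. 2.27; Rem. 2.21; Lemma 1.8–1.9] -/
theorem Pridham2024_ISemiregular_liftsOverHodgeLocus_model_finset
    (h : Pridham2024_ISemiregular_liftsOverHodgeLocus_model) (C : ChernCharacterBetti)
    {𝒳 S : Motives.SchemeOver ℂ} (π : 𝒳 ⟶ S) (n : ℕ) (hπ : Motives.IsSmoothProjectiveFamily π n)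
    (hS : _root_.AlgebraicGeometry.Smooth S.hom) {U : Set (Motives.ComplexPoints S)}
    (hU : IsCohomologicallyLocallyTrivialOn π U) (s₀ : U) (X₀ : Motives.SchemeOver ℂ)
    (e : X₀ ≅ Motives.fiberOver π s₀.1) (E₀ : X₀.left.Modules) (hE₀ : Motives.IsFiniteLocallyFree E₀)
    (I : Finset ℕ) (hsr : IsISemiregular hE₀ {q | q + 1 ∈ I})
    (hHodge : ∀ p ∈ I, ∀ (t : U) (γ : Path.Homotopic.Quotient s₀ t),
      IsOfHodgeType n (Motives.fiberOver π t.1) (2 * p) p p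
        (transportFun π (2 * p) hU γ (complexBetti.map e.inv (2 * p) (C.ch X₀ E₀ p))))
    (A B : Type) [CommRing A] [Algebra ℂ A] [IsArtinianRing A] [IsLocalRing A] [CommRing B] [Algebra ℂ B]
    (f : A →ₐ[ℂ] B) (hf : Function.Surjective f) (hsmall : IsLocalRing.maximalIdeal A * RingHom.ker f = ⊥)
    (ρ : B →ₐ[ℂ] ℂ) (a : Motives.specOver ℂ A ⟶ S)
    (ha : Spec.map (CommRingCat.ofHom (ρ.comp f).toRingHom) ≫ a.left = s₀.1.left)
    {XA XB : Scheme} (gA : XA ⟶ 𝒳.left) (qA : XA ⟶ Spec (.of A)) (hA : IsPullback gA qA π.left a.left)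
    (i : XB ⟶ XA) (qB : XB ⟶ Spec (.of B)) (hB : IsPullback i qB qA (Spec.map (CommRingCat.ofHom f.toRingHom)))
    (j : X₀.left ⟶ XB) (hj : IsPullback j X₀.hom qB (Spec.map (CommRingCat.ofHom ρ.toRingHom)))
    (hje : j ≫ i ≫ gA = e.hom.left ≫ (Motives.fiberι π s₀.1).left)
    (F : XB.Modules) (hF : Motives.IsVectorBundle F) (hF₀ : Nonempty ((Scheme.Modules.pullback j).obj F ≅ E₀)) :
    LiftsAlong i F :=
  h C π n hπ hS hU s₀ X₀ e E₀ hE₀ (↑I : Set ℕ) hsr (fun p hp => hHodge p (Finset.mem_coe.mp hp))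
    A B f hf hsmall ρ a ha gA qA hA i qB hB j hj hje F hF hF₀

/-- **The infinitesimal-lifting predicate** — the CONCLUSION of `Pridham2024_ISemiregular_liftsOverHodgeLocus_model`
packaged BY NAME (a definition, not a fact): for the smooth projective family `π : 𝒳 ⟶ S`, a complex point `s₀` of `S`,
a model `e : X₀ ≅ 𝒳_{s₀}` of the fibre and a sheaf `E₀` on `X₀`, "`E₀` lifts over every Artinian point of `S` centred at
`s₀`": for every local Artinian `ℂ`-algebra `A`, every SMALL extension `f : A ↠ B` (`𝔪_A · ker f = 0`), every `ℂ`-point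
`ρ` of `B`, every `A`-point `a : Spec A → S` whose closed point is `s₀`, every choice of base changes
`X_A = 𝒳 ×_S Spec A`, `X_B = X_A ×_A B` and of the closed fibre `j : X₀ ↪ X_B` compatible with `e` (three `IsPullback`
squares and one equation), every VECTOR BUNDLE `F` on `X_B` with `j^*F ≅ E₀` lifts to a vector bundle on `X_A`
(`Deformation.LiftsAlong`, [StacksProject, Tag 08VR]). This is lines (A)–(F) of the fact's statement verbatim,
λ-abstracted over `(π, s₀, X₀, e, E₀)`; it is the INPUT of the algebraisation step a consumer must supply
("formally smooth along the Hodge locus ⟹ deforms over an étale neighbourhood": [Lieblich2006] Thm. 4.2.1 +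
[EGAIV4] 17.14.2 / 17.16.3 (i), or [Perry2022] proof of Prop. 8.1 — NOT in this file).
[cite: Pridham2024Semiregularity, Cor. 2.25; Lemma 1.8–1.9 (the shape of the conclusion: "`[x]` lies in the image of
`e_* : π_0(FA) → π_0(FB)`")] -/
def LiftsOverArtinianPointsAt {𝒳 S : Motives.SchemeOver ℂ} (π : 𝒳 ⟶ S) (s₀ : Motives.ComplexPoints S)
    (X₀ : Motives.SchemeOver ℂ) (e : X₀ ≅ Motives.fiberOver π s₀) (E₀ : X₀.left.Modules) : Prop :=
  ∀ (A B : Type) [CommRing A] [Algebra ℂ A] [IsArtinianRing A] [IsLocalRing A]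
    [CommRing B] [Algebra ℂ B] (f : A →ₐ[ℂ] B), Function.Surjective f →
    IsLocalRing.maximalIdeal A * RingHom.ker f = ⊥ →
    ∀ (ρ : B →ₐ[ℂ] ℂ) (a : Motives.specOver ℂ A ⟶ S),
      Spec.map (CommRingCat.ofHom (ρ.comp f).toRingHom) ≫ a.left = s₀.left →
      ∀ ⦃XA XB : Scheme⦄ (gA : XA ⟶ 𝒳.left) (qA : XA ⟶ Spec (.of A)),
        IsPullback gA qA π.left a.left →
        ∀ (i : XB ⟶ XA) (qB : XB ⟶ Spec (.of B)),
          IsPullback i qB qA (Spec.map (CommRingCat.ofHom f.toRingHom)) →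
          ∀ (j : X₀.left ⟶ XB),
            IsPullback j X₀.hom qB (Spec.map (CommRingCat.ofHom ρ.toRingHom)) →
            j ≫ i ≫ gA = e.hom.left ≫ (Motives.fiberι π s₀).left →
            ∀ (F : XB.Modules), Motives.IsVectorBundle F →
              Nonempty ((Scheme.Modules.pullback j).obj F ≅ E₀) →
              LiftsAlong i F

/-- Unfolding lemma: `LiftsOverArtinianPointsAt` applied to its data IS the lifting statement (by `rfl`) — the
conclusion of [cite: Pridham2024Semiregularity, Cor. 2.25; Lemma 1.8 ("`[x]` lies in the image of `e_*`")]. -/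
theorem liftsOverArtinianPointsAt_iff {𝒳 S : Motives.SchemeOver ℂ} (π : 𝒳 ⟶ S) (s₀ : Motives.ComplexPoints S)
    (X₀ : Motives.SchemeOver ℂ) (e : X₀ ≅ Motives.fiberOver π s₀) (E₀ : X₀.left.Modules) :
    LiftsOverArtinianPointsAt π s₀ X₀ e E₀ ↔
      ∀ (A B : Type) [CommRing A] [Algebra ℂ A] [IsArtinianRing A] [IsLocalRing A]
        [CommRing B] [Algebra ℂ B] (f : A →ₐ[ℂ] B), Function.Surjective f →
        IsLocalRing.maximalIdeal A * RingHom.ker f = ⊥ →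
        ∀ (ρ : B →ₐ[ℂ] ℂ) (a : Motives.specOver ℂ A ⟶ S),
          Spec.map (CommRingCat.ofHom (ρ.comp f).toRingHom) ≫ a.left = s₀.left →
          ∀ ⦃XA XB : Scheme⦄ (gA : XA ⟶ 𝒳.left) (qA : XA ⟶ Spec (.of A)),
            IsPullback gA qA π.left a.left →
            ∀ (i : XB ⟶ XA) (qB : XB ⟶ Spec (.of B)),
              IsPullback i qB qA (Spec.map (CommRingCat.ofHom f.toRingHom)) →
              ∀ (j : X₀.left ⟶ XB),
                IsPullback j X₀.hom qB (Spec.map (CommRingCat.ofHom ρ.toRingHom)) →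
                j ≫ i ≫ gA = e.hom.left ≫ (Motives.fiberι π s₀).left →
                ∀ (F : XB.Modules), Motives.IsVectorBundle F →
                  Nonempty ((Scheme.Modules.pullback j).obj F ≅ E₀) →
                  LiftsAlong i F :=
  Iff.rfl

/-- **The fact, restated through the named conclusion** (definitional: the fact IS
"`C`, smooth projective `π` over smooth `S`, `U` cohomologically locally trivial, `s₀`, model `e`, `E₀` f.l.f.,
`I`-semiregular, classes `(p,p)` on `U` for `p ∈ I` ⟹ `LiftsOverArtinianPointsAt π s₀ X₀ e E₀`").
[cite: Pridham2024Semiregularity, Cor. 2.25; Rem. 2.27; Rem. 2.21; Lemma 1.8–1.9] -/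
theorem Pridham2024_ISemiregular_liftsOverHodgeLocus_model_iff :
    Pridham2024_ISemiregular_liftsOverHodgeLocus_model ↔
      ∀ (C : ChernCharacterBetti) ⦃𝒳 S : Motives.SchemeOver ℂ⦄ (π : 𝒳 ⟶ S) (n : ℕ),
        Motives.IsSmoothProjectiveFamily π n → _root_.AlgebraicGeometry.Smooth S.hom →
        ∀ ⦃U : Set (Motives.ComplexPoints S)⦄ (hU : IsCohomologicallyLocallyTrivialOn π U) (s₀ : U)
          (X₀ : Motives.SchemeOver ℂ) (e : X₀ ≅ Motives.fiberOver π s₀.1)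
          (E₀ : X₀.left.Modules) (hE₀ : Motives.IsFiniteLocallyFree E₀) (I : Set ℕ),
          IsISemiregular hE₀ {q | q + 1 ∈ I} →
          (∀ p ∈ I, ∀ (t : U) (γ : Path.Homotopic.Quotient s₀ t),
              IsOfHodgeType n (Motives.fiberOver π t.1) (2 * p) p p
                (transportFun π (2 * p) hU γ (complexBetti.map e.inv (2 * p) (C.ch X₀ E₀ p)))) →
          LiftsOverArtinianPointsAt π s₀.1 X₀ e E₀ :=
  Iff.rfl

/-- **Repackaged `I`-form**: under the hypotheses of the fact, `LiftsOverArtinianPointsAt π s₀ X₀ e E₀` — the named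
input a consumer's algebraisation hypothesis takes. [cite: Pridham2024Semiregularity, Cor. 2.25; Rem. 2.27; Rem. 2.21;
Lemma 1.8–1.9] -/
theorem Pridham2024_ISemiregular_liftsOverArtinianPointsAt
    (h : Pridham2024_ISemiregular_liftsOverHodgeLocus_model) (C : ChernCharacterBetti)
    {𝒳 S : Motives.SchemeOver ℂ} (π : 𝒳 ⟶ S) (n : ℕ) (hπ : Motives.IsSmoothProjectiveFamily π n)
    (hS : _root_.AlgebraicGeometry.Smooth S.hom) {U : Set (Motives.ComplexPoints S)}
    (hU : IsCohomologicallyLocallyTrivialOn π U) (s₀ : U) (X₀ : Motives.SchemeOver ℂ)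
    (e : X₀ ≅ Motives.fiberOver π s₀.1) (E₀ : X₀.left.Modules) (hE₀ : Motives.IsFiniteLocallyFree E₀)
    (I : Set ℕ) (hsr : IsISemiregular hE₀ {q | q + 1 ∈ I})
    (hHodge : ∀ p ∈ I, ∀ (t : U) (γ : Path.Homotopic.Quotient s₀ t),
      IsOfHodgeType n (Motives.fiberOver π t.1) (2 * p) p p
        (transportFun π (2 * p) hU γ (complexBetti.map e.inv (2 * p) (C.ch X₀ E₀ p)))) :
    LiftsOverArtinianPointsAt π s₀.1 X₀ e E₀ :=
  h C π n hπ hS hU s₀ X₀ e E₀ hE₀ I hsr hHodge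

/-- **Repackaged `Finset` form** (`I : Finset ℕ`, the cell's assembly binder shape).
[cite: Pridham2024Semiregularity, Cor. 2.25; Rem. 2.27; Rem. 2.21; Lemma 1.8–1.9] -/
theorem Pridham2024_ISemiregular_liftsOverArtinianPointsAt_finset
    (h : Pridham2024_ISemiregular_liftsOverHodgeLocus_model) (C : ChernCharacterBetti)
    {𝒳 S : Motives.SchemeOver ℂ} (π : 𝒳 ⟶ S) (n : ℕ) (hπ : Motives.IsSmoothProjectiveFamily π n)
    (hS : _root_.AlgebraicGeometry.Smooth S.hom) {U : Set (Motives.ComplexPoints S)}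
    (hU : IsCohomologicallyLocallyTrivialOn π U) (s₀ : U) (X₀ : Motives.SchemeOver ℂ)
    (e : X₀ ≅ Motives.fiberOver π s₀.1) (E₀ : X₀.left.Modules) (hE₀ : Motives.IsFiniteLocallyFree E₀)
    (I : Finset ℕ) (hsr : IsISemiregular hE₀ {q | q + 1 ∈ I})
    (hHodge : ∀ p ∈ I, ∀ (t : U) (γ : Path.Homotopic.Quotient s₀ t),
      IsOfHodgeType n (Motives.fiberOver π t.1) (2 * p) p p
        (transportFun π (2 * p) hU γ (complexBetti.map e.inv (2 * p) (C.ch X₀ E₀ p)))) :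
    LiftsOverArtinianPointsAt π s₀.1 X₀ e E₀ :=
  h C π n hπ hS hU s₀ X₀ e E₀ hE₀ (↑I : Set ℕ) hsr (fun p hp => hHodge p (Finset.mem_coe.mp hp))

/-- **Repackaged FULL-`σ` form** (`IsISemiregular hE₀ Set.univ`, classes `(p,p)` on `U` in every degree).
[cite: Pridham2024Semiregularity, Cor. 2.25; Rem. 2.27; Rem. 2.21; Lemma 1.8–1.9] -/
theorem Pridham2024_semiregular_liftsOverArtinianPointsAt
    (h : Pridham2024_ISemiregular_liftsOverHodgeLocus_model) (C : ChernCharacterBetti)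
    {𝒳 S : Motives.SchemeOver ℂ} (π : 𝒳 ⟶ S) (n : ℕ) (hπ : Motives.IsSmoothProjectiveFamily π n)
    (hS : _root_.AlgebraicGeometry.Smooth S.hom) {U : Set (Motives.ComplexPoints S)}
    (hU : IsCohomologicallyLocallyTrivialOn π U) (s₀ : U) (X₀ : Motives.SchemeOver ℂ)
    (e : X₀ ≅ Motives.fiberOver π s₀.1) (E₀ : X₀.left.Modules) (hE₀ : Motives.IsFiniteLocallyFree E₀)
    (hsr : IsISemiregular hE₀ Set.univ)
    (hHodge : ∀ (p : ℕ) (t : U) (γ : Path.Homotopic.Quotient s₀ t),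
      IsOfHodgeType n (Motives.fiberOver π t.1) (2 * p) p p
        (transportFun π (2 * p) hU γ (complexBetti.map e.inv (2 * p) (C.ch X₀ E₀ p)))) :
    LiftsOverArtinianPointsAt π s₀.1 X₀ e E₀ :=
  h C π n hπ hS hU s₀ X₀ e E₀ hE₀ Set.univ (IsISemiregular.mono hE₀ (fun _ _ => Set.mem_univ _) hsr)
    (fun p _ => hHodge p)

end Literature.AlgebraicGeometry.HodgeTheory

end
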